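import Summits.ABC.IUTFork.Repair.RHDiffPricedHull
import HarnessLib

/-!
# D-0122 AXIS B «REQUIREMENT-SIDE REDESIGN», knob k1 (Θ-data ⇒ WEIGHT LAW) — THE TYPED FORM, part 1: a parameterised pilot law `f` in the
# exact integer cell, calibration at print, the saturation laws deciding `j₀(w)`, the demand sums `Σ(f(j)−1)` in closed form, and the
# worked-place rows FREY `p = 7`, `l = 107`

abc-iut cell, rung LADDER-ABC:A2.RESCUE.H; seat abc-iut-reqb-typ-1 (D-0122 axis B typer k1/k2/k5; director-abc g4-D24 2026-08-27T06:00:35Z payload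
«typed form of the k1/k4 modifications (weight law `j² → j^κ`, shifted; initial Θ-data / `l`) as parameterised decls over the existing R-H currency with
`T(κ,·)` as a theorem»); spec of record abc-iut-rh-lead g3 `plan/rescue/R-H/ROUND3/REQB-SPEC.md` v0.1 a4e13bdf46b62951 §1/§3/§5; referee
abc-iut-reqb-ref-1 (PREREG a3b463e1b046ffe1, worked-place digits WP-GRID-ref-1-v1 c1c60d110a62a744). Companion (part 2, thresholds `T_mod`, k2/k5,
DOWNSTREAM `u_f(l)`, the RHTopt/MassThreshold calibrations): `Repair/RHReqsideWeightLawsThreshold.lean`.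
A «modification» is a PARAMETER CHANGE IN OUR TYPED CELL CURRENCY studied for sensitivity — NOT a claim that IUT I–III admit it (the CONSISTENCY column,
abc-iut-reqb-rf-1 / reqb-rf-2). CURRENCY (REQB-SPEC §1 = TOPT-LP-SPEC v1.2 §S2; integers per bad place `w`: `e = e_w`, `m = m_q(w)`, `δ = D`, `r_in = R_in`,
`r_out = R_out`; labels `j = 1 … l⋆`): the exact U2 cell of record `RH.DiffPricedHull.HullCellδ e m j δ r_in r_out :⟺ e·⌊(j²m − jδ − (j+1)r_in)/e⌋ ≤
m − (j+1)r_out` (ledger form `RH.HullCellSlice.hullCellδ_iff_demand_le_price`), demand `d_j = (j²−1)·m`. KNOB k1 replaces the PILOT ORDER `j²·m` and the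
DEMAND `(j²−1)·m` TOGETHER by `f(j)·m`, `(f(j) − den)·m/den` for a law `f : ℕ → ℤ` and pilot denominator `den` (REQB-SPEC §1 k1; `den = 2` carries `c₁ = 1/2`).
* §0 `ceilSqrt n = ⌈√n⌉` (the engines' exact-integer `⌈j^κ⌉`, abc-iut-reqb-ref-1 ENGINE NOTE) and the LAWS `lawPow a j = ⌈j^{a/2}⌉` (`lawPow 2 = j`,
  `lawPow 4 = j²` = PRINT, `lawPow 6 = j³`), `lawShift a j = (j+a)² − (1+a)² + 1`, `lawAffine c j = c·j²`; monotonicity; sandwiches `j ≤ ⌈j^{3/2}⌉ ≤ j² ≤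
  ⌈j^{5/2}⌉ ≤ j³`, `⌈j^{3/2}⌉ ≤ j⌈√j⌉`; certificate forms bounding `⌈j^κ⌉` by integers WITHOUT evaluating a root.
* §1 THE k1-CELL `Cell f den e m δ r_in r_out j :⟺ e·⌊(f(j)m − den(jδ + (j+1)r_in))/(den·e)⌋ ≤ m − (j+1)r_out`; CALIBRATION `Cell (j ↦ j²) 1 ⟺ HullCellδ`;
  LEDGER FORM `(f(j) − den)m ≤ den(jδ + (j+1)G) + ρ_j` (`G = r_in − r_out`) and the floor-free bracket; PILOT ANTITONICITY (`f ≤ g`: `Cell g → Cell f`);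
  SATURATION LAWS («`j₀(w) = l⋆`» in closed form — the (A)-side of the k1 × k4 rows; `m, G ≥ 0`): `κ = 1`: `m ≤ δ + G ⟹` EVERY label (an `l⋆`-FREE
  condition); `κ = 3/2`: `⌈√l⋆⌉·m ≤ δ + G ⟹` all labels `≤ l⋆`; print `κ = 2`: `l⋆·m ≤ δ + G ⟹` all labels `≤ l⋆` (sufficient short form of SLICE rows 5/8).
* §2 DEMAND SUMS `demandSum f den n = Σ_{j≤n}(f(j) − den)`: `2·Σ(j−1) = n(n−1)`, `6·Σ(j²−1) = n(n−1)(2n+5)` (abc-iut-rh2-w-1's `S(n)`, p476759),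
  `4·Σ(j³−1) = n²(n+1)² − 4n`, `6·Σ((j+a)²−(1+a)²) = n(n−1)(2n+5+6a)`, `6·Σ(c j² − den) = c·n(n+1)(2n+1) − 6·den·n`, the half-integer sandwiches — so `M_mod/M_print = demandSum_f(l⋆)/(den·S(l⋆))` is a function of `(f, l)` ALONE (part 2).
* §3 WORKED PLACE FREY `p = 7`, `l = 107` (`e 1605`, `m 210`, `δ 1604`, `r_in 268`, `r_out −4472`, `l⋆ = 53`; abc-iut-reqb-ref-1's third-engine digits): print
  `j₀ = 31`; `κ = 1`: ALL labels (saturation law `210 ≤ 6344`, and by `decide` over `53`); `κ = 3/2`: all `53` (`⌈√53⌉·210 ≤ 1680 ≤ 6344`); `κ = 5/2`: `j₀ = 10`;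
  `κ = 3`: `5`; shift `a = 1`: `29`, `a = 2`: `27`; affine `c₁ = 2`: `15`, `c₁ = 1/2`: all `53` — the CLOSES rows of the k1 singles AT THIS PLACE (bed-level rows
  are the engines' certificate, abc-iut-reqb-lp-1 / reqb-lp-2, A ≡ B).
HONEST FRAMING: integer arithmetic about OUR typed cell with a free pilot law; every law other than `j²` is a HYPOTHETICAL parameter setting, not a statement
that [EtTh]/[IUTchI–III] define such Θ-data; nothing here asserts that abc is proved or refuted, or that [IUTchIII] Cor. 3.12 / [IUTchIV] Thm. 1.10 holds or
fails at any datum, or takes a side on any author; typed ≠ proved; computed ≠ proved. [claim: Mochizuki2012, status: disputed] for every IUT locution.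
[cite: Mochizuki2012, IUTchIII Cor. 3.12 p. 173–174, Rmk. 3.9.3 p. 119–120; IUTchIV Prop. 1.4 p. 13, Thm. 1.10 Step (v) p. 27–29]
-/


noncomputable section

open Finset Set Function

namespace Summit.ABC.IUTFork.Repair.RH.ReqsideWeightLaws

open Summit.ABC.IUTFork.Repair.RH.DiffPricedHull

/-! ## §0. The ceiling square root and the laws -/

/-- `⌈√n⌉`: the least `s` with `n ≤ s²` (`0 ↦ 0`, else `⌊√(n−1)⌋ + 1`) — the engines' exact-integer reading of `⌈j^κ⌉` for half-integer `κ`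
(REQB-SPEC §1 k1; abc-iut-reqb-ref-1 ENGINE NOTE «`⌊(j^a)^{1/b}⌋` exact»). [folklore] -/
def ceilSqrt (n : ℕ) : ℕ := if n = 0 then 0 else Nat.sqrt (n - 1) + 1

/-- `n ≤ ⌈√n⌉²`. [folklore] -/
theorem le_ceilSqrt_sq (n : ℕ) : n ≤ ceilSqrt n ^ 2 := by
  unfold ceilSqrt
  split_ifs with h
  · simp [h]
  · have h1 : n - 1 < (Nat.sqrt (n - 1) + 1) ^ 2 := Nat.lt_succ_sqrt' (n - 1)
    omega

/-- Minimality: `n ≤ s² ⟹ ⌈√n⌉ ≤ s`. [folklore] -/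
theorem ceilSqrt_le_of_le_sq {n s : ℕ} (h : n ≤ s ^ 2) : ceilSqrt n ≤ s := by
  unfold ceilSqrt
  split_ifs with h0
  · exact Nat.zero_le _
  · have h1 : Nat.sqrt (n - 1) < s := Nat.sqrt_lt'.mpr (by omega)
    omega

/-- Lower bracket: `s² < n ⟹ s + 1 ≤ ⌈√n⌉`. [folklore] -/
theorem succ_le_ceilSqrt_of_sq_lt {n s : ℕ} (h : s ^ 2 < n) : s + 1 ≤ ceilSqrt n := by
  have h1 : s ^ 2 < ceilSqrt n ^ 2 := lt_of_lt_of_le h (le_ceilSqrt_sq n)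
  exact (Nat.pow_lt_pow_iff_left two_ne_zero).mp h1

/-- `⌈√(s²)⌉ = s`. [folklore] -/
theorem ceilSqrt_sq (s : ℕ) : ceilSqrt (s ^ 2) = s :=
  le_antisymm (ceilSqrt_le_of_le_sq le_rfl) ((Nat.pow_le_pow_iff_left two_ne_zero).mp (le_ceilSqrt_sq (s ^ 2)))

/-- `⌈√·⌉` is monotone. [folklore] -/
theorem ceilSqrt_mono {m n : ℕ} (h : m ≤ n) : ceilSqrt m ≤ ceilSqrt n :=
  ceilSqrt_le_of_le_sq (h.trans (le_ceilSqrt_sq n))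

/-- **k1 κ-LAW `⌈j^κ⌉`, `κ = a/2`**: `lawPow a j := ⌈√(j^a)⌉` (`a = 2, 3, 4, 5, 6` ↔ `κ = 1, 3/2, 2 (print), 5/2, 3`). A PARAMETER of our cell
currency (REQB-SPEC §1 k1), not an IUT object. [claim: Mochizuki2012, status: disputed] -/
@[claim "Mochizuki2012" "disputed"]
def lawPow (a : ℕ) (j : ℕ) : ℤ := ((ceilSqrt (j ^ a) : ℕ) : ℤ)

/-- **k1 SHIFTED LAW** `lawShift a j := (j+a)² − (1+a)² + 1` (relabelling start; normalised so that `f(1) = 1`; REQB-SPEC §1 k1, `a ∈ {1, 2}`).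
[claim: Mochizuki2012, status: disputed] -/
@[claim "Mochizuki2012" "disputed"]
def lawShift (a : ℕ) (j : ℕ) : ℤ := ((j : ℤ) + a) ^ 2 - (1 + (a : ℤ)) ^ 2 + 1

/-- **k1 AFFINE LAW** numerator `lawAffine c j := c·j²` (pilot rescaling `c₁ = c/den` with the cell's denominator `den`; REQB-SPEC §1 k1,
`c₁ ∈ {1/2, 2}`). [claim: Mochizuki2012, status: disputed] -/
@[claim "Mochizuki2012" "disputed"]
def lawAffine (c : ℕ) (j : ℕ) : ℤ := (c : ℤ) * (j : ℤ) ^ 2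

/-- `κ = 1`: `⌈√(j²)⌉ = j`. [folklore] -/
theorem lawPow_two (j : ℕ) : lawPow 2 j = (j : ℤ) := by
  unfold lawPow; rw [ceilSqrt_sq]

/-- **CALIBRATION `κ = 2` = PRINT: `⌈√(j⁴)⌉ = j²`.** [folklore] -/
theorem lawPow_four (j : ℕ) : lawPow 4 j = (j : ℤ) ^ 2 := by
  have h : ceilSqrt (j ^ 4) = j ^ 2 := by rw [show j ^ 4 = (j ^ 2) ^ 2 by ring]; exact ceilSqrt_sq _
  unfold lawPow; rw [h, Nat.cast_pow]

/-- `κ = 3`: `⌈√(j⁶)⌉ = j³`. [folklore] -/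
theorem lawPow_six (j : ℕ) : lawPow 6 j = (j : ℤ) ^ 3 := by
  have h : ceilSqrt (j ^ 6) = j ^ 3 := by rw [show j ^ 6 = (j ^ 3) ^ 2 by ring]; exact ceilSqrt_sq _
  unfold lawPow; rw [h, Nat.cast_pow]

/-- Every κ-law has `f(1) = 1` (zero demand at label `1`). [folklore] -/
theorem lawPow_at_one (a : ℕ) : lawPow a 1 = 1 := by
  simp [lawPow, ceilSqrt]

/-- The shifted law has `f(1) = 1`. [folklore] -/
theorem lawShift_at_one (a : ℕ) : lawShift a 1 = 1 := by
  unfold lawShift; ring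

/-- `a = 0`: the shifted law IS print's `j²`. [folklore] -/
theorem lawShift_zero (j : ℕ) : lawShift 0 j = (j : ℤ) ^ 2 := by
  unfold lawShift; push_cast; ring

/-- Monotone in the exponent at labels `j ≥ 1`: `a ≤ b ⟹ ⌈j^{a/2}⌉ ≤ ⌈j^{b/2}⌉`. [folklore] -/
theorem lawPow_mono_exp {a b j : ℕ} (hj : 1 ≤ j) (hab : a ≤ b) : lawPow a j ≤ lawPow b j := by
  unfold lawPow
  exact_mod_cast ceilSqrt_mono (Nat.pow_le_pow_right hj hab)

/-- Monotone in the label. [folklore] -/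
theorem lawPow_mono {a j j' : ℕ} (h : j ≤ j') : lawPow a j ≤ lawPow a j' := by
  unfold lawPow
  exact_mod_cast ceilSqrt_mono (Nat.pow_le_pow_left h a)

/-- Certificate form (upper): `j^a ≤ s² ⟹ lawPow a j ≤ s` — how a CLOSES row bounds `⌈j^κ⌉` without evaluating a square root. [folklore] -/
theorem lawPow_le_of_pow_le_sq {a j s : ℕ} (h : j ^ a ≤ s ^ 2) : lawPow a j ≤ s := by
  unfold lawPow; exact_mod_cast ceilSqrt_le_of_le_sq h

/-- Certificate form (lower): `s² < j^a ⟹ s + 1 ≤ lawPow a j`. [folklore] -/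
theorem succ_le_lawPow_of_sq_lt {a j s : ℕ} (h : s ^ 2 < j ^ a) : (s : ℤ) + 1 ≤ lawPow a j := by
  unfold lawPow; exact_mod_cast succ_le_ceilSqrt_of_sq_lt h

/-- SANDWICH `j ≤ ⌈j^{3/2}⌉ ≤ j²` at `j ≥ 1`. [folklore] -/
theorem lawPow_three_bracket {j : ℕ} (hj : 1 ≤ j) : (j : ℤ) ≤ lawPow 3 j ∧ lawPow 3 j ≤ (j : ℤ) ^ 2 := by
  refine ⟨?_, ?_⟩
  · rw [← lawPow_two j]; exact lawPow_mono_exp hj (by norm_num)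
  · rw [← lawPow_four j]; exact lawPow_mono_exp hj (by norm_num)

/-- SANDWICH `j² ≤ ⌈j^{5/2}⌉ ≤ j³` at `j ≥ 1`. [folklore] -/
theorem lawPow_five_bracket {j : ℕ} (hj : 1 ≤ j) : (j : ℤ) ^ 2 ≤ lawPow 5 j ∧ lawPow 5 j ≤ (j : ℤ) ^ 3 := by
  refine ⟨?_, ?_⟩
  · rw [← lawPow_four j]; exact lawPow_mono_exp hj (by norm_num)
  · rw [← lawPow_six j]; exact lawPow_mono_exp hj (by norm_num)

/-- `⌈j^{3/2}⌉ ≤ j·⌈√j⌉` (since `(j⌈√j⌉)² = j²⌈√j⌉² ≥ j³`). [folklore] -/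
theorem lawPow_three_le_mul_ceilSqrt (j : ℕ) : lawPow 3 j ≤ ((j * ceilSqrt j : ℕ) : ℤ) := by
  refine lawPow_le_of_pow_le_sq ?_
  have h := le_ceilSqrt_sq j
  calc j ^ 3 = j ^ 2 * j := by ring
    _ ≤ j ^ 2 * ceilSqrt j ^ 2 := Nat.mul_le_mul_left _ h
    _ = (j * ceilSqrt j) ^ 2 := by ring

/-! ## §1. The k1-cell: calibration, ledger form, pilot antitonicity, saturation laws -/

/-- **THE k1-MODIFIED EXACT CELL** at a place `(e, m, δ, r_in, r_out)` and label `j` under the pilot law `f/den`: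
`e·⌊(f(j)·m − den·(j·δ + (j+1)·r_in))/(den·e)⌋ ≤ m − (j+1)·r_out` — REQB-SPEC §1 «margin_j ≥ 0» with `j²·m_q ↦ f(j)·m_q` in the floor argument
(k3 terms `j·D`, `(j+1)·R_in`, `(j+1)·R_out`, `⌊·/e_w⌋` at their PRINT setting). A parameterised READING of our hull cell, not an IUT object.
[cite: Mochizuki2012, IUTchIV Prop. 1.4 p. 13] [claim: Mochizuki2012, status: disputed] -/
@[claim "Mochizuki2012" "disputed"]
def Cell (f : ℕ → ℤ) (den e m δ rin rout : ℤ) (j : ℕ) : Prop :=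
  e * ((f j * m - den * ((j : ℤ) * δ + ((j : ℤ) + 1) * rin)) / (den * e)) ≤ m - ((j : ℤ) + 1) * rout

/-- **CALIBRATION: at the print law `j²` (`den = 1`) the k1-cell IS `HullCellδ`** (the exact U2 cell of record), literally. [folklore] -/
theorem cell_sq_iff_hullCellδ (e m δ rin rout : ℤ) (j : ℕ) :
    Cell (fun j => (j : ℤ) ^ 2) 1 e m δ rin rout j ↔ HullCellδ e m j δ rin rout := by
  unfold Cell HullCellδ
  simp only [one_mul, sub_sub]

/-- The cell depends on the law only through its value at the label. [folklore] -/
theorem cell_congr {f g : ℕ → ℤ} {j : ℕ} (h : f j = g j) (den e m δ rin rout : ℤ) :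
    Cell f den e m δ rin rout j ↔ Cell g den e m δ rin rout j := by
  unfold Cell; rw [h]

/-- Hence `Cell (lawPow 4) 1 = HullCellδ` as well. [folklore] -/
theorem cell_lawPow_four_iff_hullCellδ (e m δ rin rout : ℤ) (j : ℕ) :
    Cell (lawPow 4) 1 e m δ rin rout j ↔ HullCellδ e m j δ rin rout :=
  (cell_congr (lawPow_four j) 1 e m δ rin rout).trans (cell_sq_iff_hullCellδ e m δ rin rout j)

/-- **LEDGER FORM** (`den > 0`): `Cell ⟺ (f(j) − den)·m ≤ den·(j·δ + (j+1)·(r_in − r_out)) + ρ_j` with the integral-structure gain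
`ρ_j = (f(j)m − den(jδ + (j+1)r_in)) mod (den·e)` — demand against price, as in `RH.HullCellSlice.hullCellδ_iff_demand_le_price`. [folklore] -/
theorem cell_iff_demand_le_price {den : ℤ} (hden : 0 < den) (f : ℕ → ℤ) (e m δ rin rout : ℤ) (j : ℕ) :
    Cell f den e m δ rin rout j ↔
      (f j - den) * m ≤ den * ((j : ℤ) * δ + ((j : ℤ) + 1) * (rin - rout))
        + (f j * m - den * ((j : ℤ) * δ + ((j : ℤ) + 1) * rin)) % (den * e) := by
  unfold Cell
  have h := Int.mul_ediv_add_emod (f j * m - den * ((j : ℤ) * δ + ((j : ℤ) + 1) * rin)) (den * e)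
  constructor
  · intro hc
    have h2 := mul_le_mul_of_nonneg_left hc hden.le
    nlinarith [h, h2]
  · intro hc
    have h2 : den * (e * ((f j * m - den * ((j : ℤ) * δ + ((j : ℤ) + 1) * rin)) / (den * e))) ≤
        den * (m - ((j : ℤ) + 1) * rout) := by nlinarith [h]
    exact le_of_mul_le_mul_left h2 hden

/-- FLOOR-FREE SUFFICIENT SIDE: `(f(j) − den)m ≤ den(jδ + (j+1)G) ⟹ Cell` (`ρ_j ≥ 0`). [folklore] -/
theorem cell_of_linear {den e : ℤ} (hden : 0 < den) (he : 0 < e) {f : ℕ → ℤ} {m δ rin rout : ℤ} {j : ℕ}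
    (h : (f j - den) * m ≤ den * ((j : ℤ) * δ + ((j : ℤ) + 1) * (rin - rout))) : Cell f den e m δ rin rout j := by
  rw [cell_iff_demand_le_price hden]
  have := Int.emod_nonneg (f j * m - den * ((j : ℤ) * δ + ((j : ℤ) + 1) * rin)) (mul_pos hden he).ne'
  linarith

/-- FLOOR-FREE NECESSARY SIDE: `Cell ⟹ (f(j) − den)m < den(jδ + (j+1)G) + den·e` (`ρ_j < den·e`). [folklore] -/
theorem linear_lt_of_cell {den e : ℤ} (hden : 0 < den) (he : 0 < e) {f : ℕ → ℤ} {m δ rin rout : ℤ} {j : ℕ}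
    (h : Cell f den e m δ rin rout j) :
    (f j - den) * m < den * ((j : ℤ) * δ + ((j : ℤ) + 1) * (rin - rout)) + den * e := by
  rw [cell_iff_demand_le_price hden] at h
  have := Int.emod_lt_of_pos (f j * m - den * ((j : ℤ) * δ + ((j : ℤ) + 1) * rin)) (mul_pos hden he)
  linarith

/-- **PILOT ANTITONICITY**: a SMALLER pilot order only helps — `f(j) ≤ g(j)`, `m ≥ 0`: `Cell g ⟹ Cell f`. (So `κ ≤ κ'` licenses at least the
labels `κ'` does; the CLOSES rows bound `⌈j^κ⌉` by certified integers through this lemma.) [folklore] -/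
theorem cell_of_le_of_cell {f g : ℕ → ℤ} {den e m δ rin rout : ℤ} (hden : 0 < den) (he : 0 < e) (hm : 0 ≤ m) {j : ℕ}
    (hfg : f j ≤ g j) (h : Cell g den e m δ rin rout j) : Cell f den e m δ rin rout j := by
  unfold Cell at h ⊢
  have hle : f j * m - den * ((j : ℤ) * δ + ((j : ℤ) + 1) * rin) ≤ g j * m - den * ((j : ℤ) * δ + ((j : ℤ) + 1) * rin) := by
    nlinarith [mul_le_mul_of_nonneg_right hfg hm]
  have hdiv := Int.ediv_le_ediv (mul_pos hden he) hle
  nlinarith [mul_le_mul_of_nonneg_left hdiv he.le]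

/-- Label `1` is IN under every law with `f(1) = den` (zero demand), given `δ ≥ 0`, `r_out ≤ r_in`. [folklore] -/
theorem cell_at_one {f : ℕ → ℤ} {den e m δ rin rout : ℤ} (hden : 0 < den) (he : 0 < e) (hf : f 1 = den) (hδ : 0 ≤ δ)
    (hG : rout ≤ rin) : Cell f den e m δ rin rout 1 := by
  refine cell_of_linear hden he ?_
  rw [hf, sub_self, zero_mul]
  push_cast
  nlinarith

/-- **SATURATION LAW, `κ = 1`** (`f = j`, `den = 1`): if `m ≤ δ + (r_in − r_out)` then EVERY label `j ≥ 1` is a cell — an `l⋆`-free condition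
(`(j−1)m ≤ (j−1)(δ+G) ≤ jδ + (j+1)G`). The k1 × k4 reading: on a genuine tower `δ + G` grows with `l` at fixed `m_q`, so under `κ = 1` every place
saturates at every `l` with `m_q ≤ D + G`. [folklore] -/
theorem cell_id_of_le {e m δ rin rout : ℤ} (he : 0 < e) (hδ : 0 ≤ δ) (hG : rout ≤ rin) (h : m ≤ δ + (rin - rout))
    {j : ℕ} (hj : 1 ≤ j) : Cell (fun j => (j : ℤ)) 1 e m δ rin rout j := by
  refine cell_of_linear one_pos he ?_
  have hj' : (1 : ℤ) ≤ j := by exact_mod_cast hj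
  have h1 : ((j : ℤ) - 1) * m ≤ ((j : ℤ) - 1) * (δ + (rin - rout)) := mul_le_mul_of_nonneg_left h (by linarith)
  linarith

/-- **SATURATION LAW, `κ = 3/2`** (`f = ⌈j^{3/2}⌉`, `den = 1`; `m ≥ 0`, `δ ≥ 0`, `r_out ≤ r_in`): `⌈√j⌉·m ≤ δ + G ⟹` label `j` is a cell
(`(⌈j^{3/2}⌉ − 1)m ≤ (j⌈√j⌉ − 1)m ≤ jδ + (j+1)G`). [folklore] -/
theorem cell_lawPow_three_of_le {e m δ rin rout : ℤ} (he : 0 < e) (hm : 0 ≤ m) (hG : rout ≤ rin) {j : ℕ}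
    (hj : 1 ≤ j) (h : (ceilSqrt j : ℤ) * m ≤ δ + (rin - rout)) : Cell (lawPow 3) 1 e m δ rin rout j := by
  refine cell_of_linear one_pos he ?_
  have h1 : lawPow 3 j ≤ ((j * ceilSqrt j : ℕ) : ℤ) := lawPow_three_le_mul_ceilSqrt j
  have h2 : (lawPow 3 j - 1) * m ≤ (((j * ceilSqrt j : ℕ) : ℤ) - 1) * m := mul_le_mul_of_nonneg_right (by linarith) hm
  push_cast at h2
  have hj' : (1 : ℤ) ≤ j := by exact_mod_cast hj
  have h3 : (j : ℤ) * ((ceilSqrt j : ℤ) * m) ≤ (j : ℤ) * (δ + (rin - rout)) := mul_le_mul_of_nonneg_left h (by linarith)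
  nlinarith

/-- … hence `⌈√l⋆⌉·m ≤ δ + G ⟹` EVERY label `1 ≤ j ≤ l⋆` is a `κ = 3/2` cell («`j₀(w) = l⋆`»; on a tower LHS `∝ √l`, RHS `∝ l`). [folklore] -/
theorem cell_lawPow_three_all {e m δ rin rout : ℤ} (he : 0 < e) (hm : 0 ≤ m) (hG : rout ≤ rin) {lstar : ℕ}
    (h : (ceilSqrt lstar : ℤ) * m ≤ δ + (rin - rout)) {j : ℕ} (hj : 1 ≤ j) (hjl : j ≤ lstar) :
    Cell (lawPow 3) 1 e m δ rin rout j := by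
  refine cell_lawPow_three_of_le he hm hG hj ?_
  have hc : (ceilSqrt j : ℤ) ≤ ceilSqrt lstar := by exact_mod_cast ceilSqrt_mono hjl
  nlinarith

/-- **SATURATION LAW, print `κ = 2`** (sufficient short form of SLICE rows 5/8): `l⋆·m ≤ δ + G ⟹` every label `1 ≤ j ≤ l⋆` is a cell
(`(j²−1)m ≤ j·(jm) ≤ j(δ+G) ≤ jδ + (j+1)G`); on a tower both sides `∝ l` — the `l`-FREE ratio of D-0121 (2). [folklore] -/
theorem cell_sq_all {e m δ rin rout : ℤ} (he : 0 < e) (hm : 0 ≤ m) (hG : rout ≤ rin) {lstar : ℕ}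
    (h : (lstar : ℤ) * m ≤ δ + (rin - rout)) {j : ℕ} (hj : 1 ≤ j) (hjl : j ≤ lstar) :
    Cell (fun j => (j : ℤ) ^ 2) 1 e m δ rin rout j := by
  refine cell_of_linear one_pos he ?_
  have hj' : (1 : ℤ) ≤ j := by exact_mod_cast hj
  have hjl' : (j : ℤ) ≤ lstar := by exact_mod_cast hjl
  have h1 : (j : ℤ) * m ≤ δ + (rin - rout) := by nlinarith
  have h2 : (j : ℤ) * ((j : ℤ) * m) ≤ (j : ℤ) * (δ + (rin - rout)) := mul_le_mul_of_nonneg_left h1 (by linarith)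
  nlinarith

/-! ## §2. Demand sums in closed form (the requirement side's label arithmetic) -/

/-- **`demandSum f den n := Σ_{j=1}^{n} (f(j) − den)`** — the place-free demand of the labels `1 … n` under the law `f/den`, in units of `m_q·u_w/den`
(so `Σ_w Σ_{j≤n} d_j u_w = (demandSum/den)·Σ_w m_q(w)u_w`). [folklore] -/
def demandSum (f : ℕ → ℤ) (den : ℤ) (n : ℕ) : ℤ := ∑ i ∈ Finset.range n, (f (i + 1) - den)

/-- Recursion. [folklore] -/
theorem demandSum_succ (f : ℕ → ℤ) (den : ℤ) (n : ℕ) : demandSum f den (n + 1) = demandSum f den n + (f (n + 1) - den) :=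
  Finset.sum_range_succ _ _

/-- `demandSum` depends on `f` only at labels `≥ 1`. [folklore] -/
theorem demandSum_congr {f g : ℕ → ℤ} (h : ∀ j, 1 ≤ j → f j = g j) (den : ℤ) (n : ℕ) : demandSum f den n = demandSum g den n :=
  Finset.sum_congr rfl fun i _ => by rw [h (i + 1) (Nat.succ_pos i)]

/-- Monotone in the law. [folklore] -/
theorem demandSum_mono {f g : ℕ → ℤ} (h : ∀ j, 1 ≤ j → f j ≤ g j) (den : ℤ) (n : ℕ) : demandSum f den n ≤ demandSum g den n :=
  Finset.sum_le_sum fun i _ => by linarith [h (i + 1) (Nat.succ_pos i)]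

/-- **`κ = 1`: `2·Σ_{j≤n}(j − 1) = n(n−1)`.** [folklore] -/
theorem two_mul_demandSum_id (n : ℕ) : 2 * demandSum (fun j => (j : ℤ)) 1 n = (n : ℤ) * (n - 1) := by
  induction n with
  | zero => simp [demandSum]
  | succ n ih => rw [demandSum_succ, mul_add, ih]; push_cast; ring

/-- **PRINT `κ = 2`: `6·Σ_{j≤n}(j² − 1) = n(n−1)(2n+5)`** (`= 6·S(n)`; `RH.CellWeights.sum_fin_sqSubOne` in `ℤ`). [folklore] -/
theorem six_mul_demandSum_sq (n : ℕ) : 6 * demandSum (fun j => (j : ℤ) ^ 2) 1 n = (n : ℤ) * (n - 1) * (2 * n + 5) := by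
  induction n with
  | zero => simp [demandSum]
  | succ n ih => rw [demandSum_succ, mul_add, ih]; push_cast; ring

/-- **`κ = 3`: `4·Σ_{j≤n}(j³ − 1) = n²(n+1)² − 4n`.** [folklore] -/
theorem four_mul_demandSum_cube (n : ℕ) : 4 * demandSum (fun j => (j : ℤ) ^ 3) 1 n = (n : ℤ) ^ 2 * (n + 1) ^ 2 - 4 * n := by
  induction n with
  | zero => simp [demandSum]
  | succ n ih => rw [demandSum_succ, mul_add, ih]; push_cast; ring

/-- **SHIFT `a`: `6·Σ_{j≤n}((j+a)² − (1+a)²) = n(n−1)(2n+5+6a)`** (`= 6S(n) + 6a·n(n−1)/…`: print plus `a·n(n−1)`). [folklore] -/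
theorem six_mul_demandSum_shift (a n : ℕ) : 6 * demandSum (lawShift a) 1 n = (n : ℤ) * (n - 1) * (2 * n + 5 + 6 * a) := by
  induction n with
  | zero => simp [demandSum]
  | succ n ih => rw [demandSum_succ, mul_add, ih]; unfold lawShift; push_cast; ring

/-- **AFFINE `c/den`: `6·Σ_{j≤n}(c·j² − den) = c·n(n+1)(2n+1) − 6·den·n`.** [folklore] -/
theorem six_mul_demandSum_affine (c : ℕ) (den : ℤ) (n : ℕ) :
    6 * demandSum (lawAffine c) den n = (c : ℤ) * n * (n + 1) * (2 * n + 1) - 6 * den * n := by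
  induction n with
  | zero => simp [demandSum]
  | succ n ih => rw [demandSum_succ, mul_add, ih]; unfold lawAffine; push_cast; ring

/-- SANDWICH for the half-integer laws: `Σ(j−1) ≤ Σ(⌈j^{3/2}⌉−1) ≤ Σ(j²−1) ≤ Σ(⌈j^{5/2}⌉−1) ≤ Σ(j³−1)`. [folklore] -/
theorem demandSum_halfInteger_bracket (n : ℕ) :
    demandSum (fun j => (j : ℤ)) 1 n ≤ demandSum (lawPow 3) 1 n ∧ demandSum (lawPow 3) 1 n ≤ demandSum (fun j => (j : ℤ) ^ 2) 1 n ∧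
      demandSum (fun j => (j : ℤ) ^ 2) 1 n ≤ demandSum (lawPow 5) 1 n ∧ demandSum (lawPow 5) 1 n ≤ demandSum (fun j => (j : ℤ) ^ 3) 1 n :=
  ⟨demandSum_mono (fun _ hj => (lawPow_three_bracket hj).1) 1 n, demandSum_mono (fun _ hj => (lawPow_three_bracket hj).2) 1 n,
    demandSum_mono (fun _ hj => (lawPow_five_bracket hj).1) 1 n, demandSum_mono (fun _ hj => (lawPow_five_bracket hj).2) 1 n⟩

/-- `S(n) > 0` for `n ≥ 2` (print demand sum positive). [folklore] -/
theorem demandSum_sq_pos {n : ℕ} (hn : 2 ≤ n) : 0 < demandSum (fun j => (j : ℤ) ^ 2) 1 n := by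
  have h := six_mul_demandSum_sq n
  have hn' : (2 : ℤ) ≤ n := by exact_mod_cast hn
  have hp : 0 < (n : ℤ) * (n - 1) * (2 * n + 5) := mul_pos (mul_pos (by linarith) (by linarith)) (by linarith)
  linarith

/-! ## §3. The worked place FREY `p = 7`, `l = 107`: `e = 1605`, `m = 210`, `δ = 1604`, `r_in = 268`, `r_out = −4472`, `l⋆ = 53` -/

/-- PRINT (regression row): `j₀ = 31` — label `31` IN, `32` OUT (abc-iut-reqb-ref-1 WP-GRID: `j₀ 31`, `μ₄ 0.20368`). [folklore] -/
theorem worked_print : Cell (fun j => (j : ℤ) ^ 2) 1 1605 210 1604 268 (-4472) 31 ∧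
    ¬ Cell (fun j => (j : ℤ) ^ 2) 1 1605 210 1604 268 (-4472) 32 := by
  unfold Cell; decide

/-- **`κ = 1` CLOSES AT THE PLACE: every label `j ≥ 1` is a cell** — by the saturation law (`210 ≤ 1604 + 4740 = 6344`), no enumeration. [folklore] -/
theorem worked_kappaOne_all {j : ℕ} (hj : 1 ≤ j) : Cell (fun j => (j : ℤ)) 1 1605 210 1604 268 (-4472) j :=
  cell_id_of_le (by norm_num) (by norm_num) (by norm_num) (by norm_num) hj

/-- The same by exhaustion over the `53` labels (engine-shaped certificate). [folklore] -/
theorem worked_kappaOne_decide : ∀ i : Fin 53, Cell (fun j => (j : ℤ)) 1 1605 210 1604 268 (-4472) (i.val + 1) := by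
  unfold Cell; decide

/-- **`κ = 3/2` CLOSES AT THE PLACE: every label `1 ≤ j ≤ 53` is a cell** (`⌈√53⌉ ≤ 8`, `8·210 = 1680 ≤ 6344`). [folklore] -/
theorem worked_kappaThreeHalves_all {j : ℕ} (hj : 1 ≤ j) (hjl : j ≤ 53) : Cell (lawPow 3) 1 1605 210 1604 268 (-4472) j := by
  have h8 : (ceilSqrt 53 : ℤ) ≤ 8 := by exact_mod_cast ceilSqrt_le_of_le_sq (show 53 ≤ 8 ^ 2 by norm_num)
  exact cell_lawPow_three_all (by norm_num) (by norm_num) (by norm_num) (by linarith) hj hjl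

/-- `κ = 5/2`: `j₀ = 10` (label `10` IN via `⌈10^{5/2}⌉ ≤ 317`, `317² ≥ 10⁵`; label `11` OUT via `⌈11^{5/2}⌉ ≥ 402`, `401² < 11⁵`). [folklore] -/
theorem worked_kappaFiveHalves : Cell (lawPow 5) 1 1605 210 1604 268 (-4472) 10 ∧ ¬ Cell (lawPow 5) 1 1605 210 1604 268 (-4472) 11 := by
  refine ⟨?_, fun h => ?_⟩
  · have hup : lawPow 5 10 ≤ (317 : ℕ) := lawPow_le_of_pow_le_sq (by norm_num)
    have hc : Cell (fun _ => (317 : ℤ)) 1 1605 210 1604 268 (-4472) 10 := by unfold Cell; decide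
    exact cell_of_le_of_cell one_pos (by norm_num) (by norm_num) (by exact_mod_cast hup) hc
  · have hlo : (401 : ℤ) + 1 ≤ lawPow 5 11 := by exact_mod_cast succ_le_lawPow_of_sq_lt (a := 5) (j := 11) (s := 401) (by norm_num)
    have hc : ¬ Cell (fun _ => (402 : ℤ)) 1 1605 210 1604 268 (-4472) 11 := by unfold Cell; decide
    exact hc (cell_of_le_of_cell one_pos (by norm_num) (by norm_num) (by linarith) h)

/-- `κ = 3`: `j₀ = 5`. [folklore] -/
theorem worked_kappaThree : Cell (lawPow 6) 1 1605 210 1604 268 (-4472) 5 ∧ ¬ Cell (lawPow 6) 1 1605 210 1604 268 (-4472) 6 := by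
  rw [cell_congr (f := lawPow 6) (g := fun j => (j : ℤ) ^ 3) (j := 5) (lawPow_six 5),
    cell_congr (f := lawPow 6) (g := fun j => (j : ℤ) ^ 3) (j := 6) (lawPow_six 6)]
  unfold Cell; decide

/-- Shift `a = 1`: `j₀ = 29`; `a = 2`: `j₀ = 27`. [folklore] -/
theorem worked_shift : (Cell (lawShift 1) 1 1605 210 1604 268 (-4472) 29 ∧ ¬ Cell (lawShift 1) 1 1605 210 1604 268 (-4472) 30) ∧
    (Cell (lawShift 2) 1 1605 210 1604 268 (-4472) 27 ∧ ¬ Cell (lawShift 2) 1 1605 210 1604 268 (-4472) 28) := by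
  unfold Cell lawShift; decide

/-- Affine `c₁ = 2`: `j₀ = 15`; `c₁ = 1/2` (`f = j²`, `den = 2`): ALL `53` labels. [folklore] -/
theorem worked_affine : (Cell (lawAffine 2) 1 1605 210 1604 268 (-4472) 15 ∧ ¬ Cell (lawAffine 2) 1 1605 210 1604 268 (-4472) 16) ∧
    ∀ i : Fin 53, Cell (lawAffine 1) 2 1605 210 1604 268 (-4472) (i.val + 1) := by
  unfold Cell lawAffine; decide

end Summit.ABC.IUTFork.Repair.RH.ReqsideWeightLaws

end
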